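import Mathlib
import HarnessLib.Audit
import Summits.PneNP.PneNP.Theorems.PstarGConstraint
import Summits.PneNP.PneNP.Theorems.PstarChordEndgameTools

/-!
# Chords of a core under a G-constraint system: the forcing lemmas (C1)/(C2) and the chord count (ROUND-24, GAPTWO-PLAN §2)

FRONTIER range-avoidance ladder, rung F-N3, ROUND 24 (cell `pnp-ideate`, planner memo `r24/GAPTWO-PLAN.md` v0 §2 "chord–support
lemma"; restricted-model proof complexity — nothing here bears on `P` versus `NP`).

Setting (terminal normal form of the `|W| = 2` analysis, after `PstarReaderCoreSystem` / `PstarGSystemFold` / `PstarGSystemFreeVar`):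
a CORE `J` of outputs of a pure `P⋆` instance and a finite SYSTEM `𝒲` of G-constraints `(C, G, b)` ("`gval I C G z = b`") such that
`J ∧ 𝒲` has NO solution.  For `g ∈ J` write `REST_g := (J ∖ g) ∧ 𝒲`; `u, v` = XOR slots, `p, p'` = AND slots of `g`,
`c_g(z) := z_u ⊕ z_v ⊕ y_g` (so `g` says `z_p ∧ z_{p'} = c_g`).

* `rest_violates` — (C2) of the memo, which is automatic: every solution of `REST_g` violates `g`, i.e. `z_p z_{p'} ⊕ c_g = 1`.
* **`forces_of_free_and_slot`** — (C1): if the AND slot `p'` of `g` is `J`-private and FREE for the system (changing `z_{p'}` keeps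
  `𝒲` satisfied — e.g. `p' ∉ gsupp 𝒲`, `PstarGSystemSupport.gholds_update_of_notMem`), then every solution of `REST_g` has
  `z_p = false` and `c_g = true`: `REST_g` FORCES the negative literal `¬a_p` and the parity `x_u + x_v = y_g + 1`.  Contrapositive
  for the core alone (`fails_of_free_and_slot`): on a solution of `J ∖ g` with `z_p = true` or `c_g = false` the system fails.
  (If also `p` is `J`-private and free, `g` is removable — (C0), `PstarGSystemSupport.solvable_of_two_private`.)
* Chord counting under (T1) "no `J`-private XOR slot" with `(r, 3/2)`-boundary expansion and `|J| ≤ r`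
  (`PstarChordEndgameTools.three_card_le`: `3|J| ≤ 2·Σ_f #privAnd f = 2(2·ch + k₁)`):
  `nonchords_add_le_chords` (`k₁ + 3·oth ≤ ch`, stated as `#non-chords + 2·#(no private AND slot) ≤ #chords`) and
  **`card_le_two_mul_card_chords`** (`|J| ≤ 2·ch`); and `card_chords_le_of_meets` (chords holding a variable of a set `S` privately are
  counted injectively by `S ∩ bdry J`, their AND pairs being disjoint), whence `card_le_two_mul_of_chords_meet`:
  `|J| ≤ 2·|S ∩ bdry J|` whenever every chord has an AND slot in `S` — the memo's count (★) `|J₀| ≤ 2·ch ≤ 2·|S ∩ priv(J₀)|`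
  along its own route (the support route is `PstarGSystemSupport.card_le_two_mul_card_bdry_inter_gsupp`).

Only `IsPure` is used for the forcing lemmas; the counts use expansion (and nothing else).
-/

set_option linter.dupNamespace false -- `Summit.PneNP.PneNP.…`: summit = sub-problem name (D-0017 single-conjunct layout)

open Finset Literature.Computability.Complexity
open Summit.PneNP.PneNP.Theorems.PstarSALevel (varSet bdry BoundaryExpanding)
open Summit.PneNP.PneNP.Theorems.PstarGapLinearised (andPair andPair_subset_varSet)
open Summit.PneNP.PneNP.Theorems.PstarGapPeeling (not_mem_varSet_of_private eval_update_of_not_mem eval_pure)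
open Summit.PneNP.PneNP.Theorems.PstarCentreFree (vars_mem_varSet)
open Summit.PneNP.PneNP.Theorems.PstarGapOneAll (gval)
open Summit.PneNP.PneNP.Theorems.PstarChordRepair (IsChord)
open Summit.PneNP.PneNP.Theorems.PstarGapOneKills (mem_andPair_of_slot ge2_pair)
open Summit.PneNP.PneNP.Theorems.PstarChordEndgameTools (privAnd card_privAnd_le_two card_privAnd_le_one three_card_le
  andPair_subset_bdry_of_isChord disjoint_andPair_of_isChord)

namespace Summit.PneNP.PneNP.Theorems.PstarChordSupport

variable {n m : ℕ}

/-! ## One AND slot moved, the other fixed -/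

/-- Setting the AND slot `sl` of `j` to `a` gives output `j` the value `u₀ ⊕ u₁ ⊕ (a ∧ z_{sd})`, `sd` the other AND slot. -/
theorem eval_update_and_slot (I : LocalMap 4 n m) (hI : I.IsPure xorAndPred) (z : Fin n → Bool) (j : Fin m) {sl sd : Fin 4}
    (hsl : sl = 2 ∧ sd = 3 ∨ sl = 3 ∧ sd = 2) (a : Bool) :
    I.eval (Function.update z (I.vars j sl) a) j = xor (xor (z (I.vars j 0)) (z (I.vars j 1))) (a && z (I.vars j sd)) := by
  have hinj := hI.2 j
  have hne : ∀ t t' : Fin 4, t ≠ t' → I.vars j t ≠ I.vars j t' := fun t t' ht h => ht (hinj h)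
  rw [eval_pure I hI]
  rcases hsl with ⟨rfl, rfl⟩ | ⟨rfl, rfl⟩
  · rw [Function.update_of_ne (hne 0 2 (by decide)), Function.update_of_ne (hne 1 2 (by decide)),
      Function.update_of_ne (hne 3 2 (by decide)), Function.update_self]
  · rw [Function.update_of_ne (hne 0 3 (by decide)), Function.update_of_ne (hne 1 3 (by decide)),
      Function.update_of_ne (hne 2 3 (by decide)), Function.update_self, Bool.and_comm]

/-! ## The forcing lemmas -/

section Forcing

variable (I : LocalMap 4 n m) (hI : I.IsPure xorAndPred) (y : Fin m → Bool) {J : Finset (Fin m)}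
  (𝒲 : Finset (Finset (Fin n) × Finset (Fin m) × Bool))
  (hinf : ¬ ∃ z : Fin n → Bool, (∀ j ∈ J, I.eval z j = y j) ∧ ∀ w ∈ 𝒲, gval I w.1 w.2.1 z = w.2.2)

include hinf

/-- **(C2): every solution of `REST_g` violates `g`.** -/
theorem rest_violates {g : Fin m} {z : Fin n → Bool} (hzJ : ∀ j ∈ J, j ≠ g → I.eval z j = y j)
    (hz𝒲 : ∀ w ∈ 𝒲, gval I w.1 w.2.1 z = w.2.2) : I.eval z g ≠ y g :=
  fun h => hinf ⟨z, fun j hj => if hjg : j = g then hjg ▸ h else hzJ j hj hjg, hz𝒲⟩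

include hI

/-- (C2) in product form: on a solution of `REST_g`, `z_p ∧ z_{p'} = ¬ c_g`, i.e. `z_p z_{p'} + c_g = 1`. -/
theorem rest_product_ne {g : Fin m} {z : Fin n → Bool} (hzJ : ∀ j ∈ J, j ≠ g → I.eval z j = y j)
    (hz𝒲 : ∀ w ∈ 𝒲, gval I w.1 w.2.1 z = w.2.2) :
    (z (I.vars g 2) && z (I.vars g 3)) = ! xor (xor (z (I.vars g 0)) (z (I.vars g 1))) (y g) := by
  have h := rest_violates I y 𝒲 hinf hzJ hz𝒲
  rw [eval_pure I hI] at h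
  revert h
  cases z (I.vars g 0) <;> cases z (I.vars g 1) <;> cases (z (I.vars g 2) && z (I.vars g 3)) <;> cases y g <;> decide

/-- **(C1): a free private AND slot forces the other AND variable to `0` and the XOR part to `¬y_g`.**  Let the AND slot `sd` of
`g ∈ J` be `J`-private and free for the system `𝒲`.  Then every solution `z` of `REST_g = (J ∖ g) ∧ 𝒲` has `z_{p_{sl}} = false` and
`z_u ⊕ z_v = ¬ y_g` (else re-setting `z_{p_{sd}}` would solve `J ∧ 𝒲`). -/
theorem forces_of_free_and_slot {g : Fin m} (hg : g ∈ J) {sl sd : Fin 4} (hsl : sl = 2 ∧ sd = 3 ∨ sl = 3 ∧ sd = 2)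
    (hbd : I.vars g sd ∈ bdry I J)
    (hfree : ∀ (z : Fin n → Bool) (b : Bool), (∀ w ∈ 𝒲, gval I w.1 w.2.1 z = w.2.2) →
      ∀ w ∈ 𝒲, gval I w.1 w.2.1 (Function.update z (I.vars g sd) b) = w.2.2)
    {z : Fin n → Bool} (hzJ : ∀ j ∈ J, j ≠ g → I.eval z j = y j) (hz𝒲 : ∀ w ∈ 𝒲, gval I w.1 w.2.1 z = w.2.2) :
    z (I.vars g sl) = false ∧ xor (z (I.vars g 0)) (z (I.vars g 1)) = ! y g := by
  have hsd' : sd = 2 ∧ sl = 3 ∨ sd = 3 ∧ sl = 2 := by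
    rcases hsl with ⟨h1, h2⟩ | ⟨h1, h2⟩
    · exact Or.inr ⟨h2, h1⟩
    · exact Or.inl ⟨h2, h1⟩
  -- re-setting the private free slot keeps `REST_g` solved, so the new point still violates `g`
  have hviol : ∀ b : Bool, xor (xor (z (I.vars g 0)) (z (I.vars g 1))) (b && z (I.vars g sl)) ≠ y g := by
    intro b h
    refine hinf ⟨Function.update z (I.vars g sd) b, fun j hj => ?_, hfree z b hz𝒲⟩
    by_cases hjg : j = g
    · subst hjg
      rw [eval_update_and_slot I hI z j hsd' b, h]
    · rw [eval_update_of_not_mem I j z (not_mem_varSet_of_private I hg hj hjg hbd (vars_mem_varSet I g sd)) b]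
      exact hzJ j hj hjg
  have h0 := hviol false
  have h1 := hviol true
  revert h0 h1
  cases z (I.vars g 0) <;> cases z (I.vars g 1) <;> cases z (I.vars g sl) <;> cases y g <;> decide

/-- **(C1), contrapositive for the core alone.**  With the AND slot `sd` of `g` private and free for `𝒲`: a solution of `J ∖ g` on
which `z_{p_{sl}} = true` or `z_u ⊕ z_v = y_g` FAILS the system. -/
theorem fails_of_free_and_slot {g : Fin m} (hg : g ∈ J) {sl sd : Fin 4} (hsl : sl = 2 ∧ sd = 3 ∨ sl = 3 ∧ sd = 2)
    (hbd : I.vars g sd ∈ bdry I J)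
    (hfree : ∀ (z : Fin n → Bool) (b : Bool), (∀ w ∈ 𝒲, gval I w.1 w.2.1 z = w.2.2) →
      ∀ w ∈ 𝒲, gval I w.1 w.2.1 (Function.update z (I.vars g sd) b) = w.2.2)
    {z : Fin n → Bool} (hzJ : ∀ j ∈ J, j ≠ g → I.eval z j = y j)
    (hor : z (I.vars g sl) = true ∨ xor (z (I.vars g 0)) (z (I.vars g 1)) = y g) :
    ∃ w ∈ 𝒲, gval I w.1 w.2.1 z ≠ w.2.2 := by
  by_contra hno
  push Not at hno
  obtain ⟨h1, h2⟩ := forces_of_free_and_slot I hI y 𝒲 hinf hg hsl hbd hfree hzJ hno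
  rcases hor with h | h
  · rw [h1] at h; exact Bool.false_ne_true h
  · rw [h2] at h; revert h; cases y g <;> decide

/-- **(C0) as a forcing statement.**  If BOTH AND slots of `g` are private and free for `𝒲`, then `REST_g` has no solution at all
(`g` would be removable): cf. `PstarGSystemSupport.solvable_of_two_private`. -/
theorem rest_unsolvable_of_two_free {g : Fin m} (hg : g ∈ J) (hc : IsChord I J g)
    (hfree2 : ∀ (z : Fin n → Bool) (b : Bool), (∀ w ∈ 𝒲, gval I w.1 w.2.1 z = w.2.2) →
      ∀ w ∈ 𝒲, gval I w.1 w.2.1 (Function.update z (I.vars g 2) b) = w.2.2)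
    (hfree3 : ∀ (z : Fin n → Bool) (b : Bool), (∀ w ∈ 𝒲, gval I w.1 w.2.1 z = w.2.2) →
      ∀ w ∈ 𝒲, gval I w.1 w.2.1 (Function.update z (I.vars g 3) b) = w.2.2)
    {z : Fin n → Bool} (hzJ : ∀ j ∈ J, j ≠ g → I.eval z j = y j) (hz𝒲 : ∀ w ∈ 𝒲, gval I w.1 w.2.1 z = w.2.2) : False := by
  -- (C1) through slot 3 forces `z_{p_2} = false` and `c_g = true`; then setting `z_{p_2} := true` keeps REST solved and, by (C1)
  -- through slot 3 again, would force `true = false`.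
  obtain ⟨h2, -⟩ := forces_of_free_and_slot I hI y 𝒲 hinf hg (Or.inl ⟨rfl, rfl⟩) hc.2 hfree3 hzJ hz𝒲
  set z' := Function.update z (I.vars g 2) true with hz'
  have hz'J : ∀ j ∈ J, j ≠ g → I.eval z' j = y j := fun j hj hjg => by
    rw [hz', eval_update_of_not_mem I j z (not_mem_varSet_of_private I hg hj hjg hc.1 (vars_mem_varSet I g 2)) true]
    exact hzJ j hj hjg
  obtain ⟨h2', -⟩ := forces_of_free_and_slot I hI y 𝒲 hinf hg (Or.inl ⟨rfl, rfl⟩) hc.2 hfree3 hz'J (hfree2 z true hz𝒲)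
  rw [hz', Function.update_self] at h2'
  exact Bool.noConfusion h2'

end Forcing

/-! ## Chord counting under (T1) -/

section Count

variable (I : LocalMap 4 n m) (J : Finset (Fin m)) {r : ℕ} (hB : BoundaryExpanding r I) (hJr : J.card ≤ r)
  (hnx : ∀ g ∈ J, ∀ s : Fin 4, s.val < 2 → I.vars g s ∉ bdry I J)

/-- A chord has exactly its two AND slots private; in particular `#privAnd = 2` needs purity, but `≤ 2` always holds and a
non-chord has `≤ 1` (`PstarChordEndgameTools`).  Sum form: `Σ_f #privAnd f ≤ 2·ch + (#J - ch) = #J + ch`. -/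
theorem sum_privAnd_le [DecidablePred (IsChord I J)] :
    ∑ f ∈ J, (privAnd I J f).card ≤ J.card + (J.filter (IsChord I J)).card := by
  classical
  have key : ∀ f ∈ J, (privAnd I J f).card ≤ 1 + if IsChord I J f then 1 else 0 := by
    intro f _
    by_cases h : IsChord I J f
    · rw [if_pos h]; exact card_privAnd_le_two I J f
    · rw [if_neg h]; exact card_privAnd_le_one I J h
  refine (sum_le_sum key).trans (le_of_eq ?_)
  rw [sum_add_distrib, sum_const, smul_eq_mul, mul_one, ← card_filter]

include hB hJr hnx

/-- **`|J| ≤ 2·#chords`** under (T1) and expansion: the core is dominated by its chords. -/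
theorem card_le_two_mul_card_chords [DecidablePred (IsChord I J)] : J.card ≤ 2 * (J.filter (IsChord I J)).card := by
  have h1 := three_card_le I J hB hJr hnx
  have h2 := sum_privAnd_le I J
  omega

/-- **`k₁ + 3·oth ≤ ch`** under (T1) and expansion, in the form `#non-chords + 2·#(outputs with no private AND slot) ≤ #chords`. -/
theorem nonchords_add_le_chords [DecidablePred (IsChord I J)] :
    (J.filter fun f => ¬ IsChord I J f).card + 2 * (J.filter fun f => privAnd I J f = ∅).card ≤
      (J.filter (IsChord I J)).card := by
  classical
  have h1 := three_card_le I J hB hJr hnx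
  -- refine the per-output bound: outputs with no private AND slot contribute `0`
  have key : ∀ f ∈ J, (privAnd I J f).card + (if privAnd I J f = ∅ then 1 else 0) ≤ 1 + if IsChord I J f then 1 else 0 := by
    intro f _
    by_cases h0 : privAnd I J f = ∅
    · rw [if_pos h0, h0, card_empty]
      split_ifs <;> omega
    · rw [if_neg h0, add_zero]
      by_cases h : IsChord I J f
      · rw [if_pos h]; exact card_privAnd_le_two I J f
      · rw [if_neg h]; exact card_privAnd_le_one I J h
  have h2 := sum_le_sum key
  rw [sum_add_distrib, sum_add_distrib, sum_const, smul_eq_mul, mul_one, ← card_filter, ← card_filter] at h2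
  have h3 : (J.filter (IsChord I J)).card + (J.filter fun f => ¬ IsChord I J f).card = J.card :=
    Finset.card_filter_add_card_filter_not (IsChord I J)
  have h4 : (filter (fun f => privAnd I J f = ∅) J).card = (J.filter fun f => privAnd I J f = ∅).card := by congr 1
  have h5 : (filter (fun f => IsChord I J f) J).card = (J.filter (IsChord I J)).card := by congr 1
  omega

omit hB hJr hnx

/-- **Chords meeting `S` are counted by `S ∩ bdry J`**: if every chord of `J` has an AND slot in `S`, then, the AND pairs of distinct
chords being disjoint and private, `#chords ≤ |S ∩ bdry J|`. -/
theorem card_chords_le_of_meets [DecidablePred (IsChord I J)] (S : Finset (Fin n))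
    (hS : ∀ g ∈ J, IsChord I J g → I.vars g 2 ∈ S ∨ I.vars g 3 ∈ S) :
    (J.filter (IsChord I J)).card ≤ (S ∩ bdry I J).card := by
  classical
  -- choose for each chord a private AND slot in `S`
  set φ : Fin m → Fin n := fun g => if I.vars g 2 ∈ S then I.vars g 2 else I.vars g 3 with hφdef
  have hφ : ∀ g ∈ J.filter (IsChord I J), φ g ∈ S ∩ bdry I J := by
    intro g hg
    obtain ⟨hgJ, hc⟩ := mem_filter.1 hg
    by_cases h2 : I.vars g 2 ∈ S
    · rw [hφdef]; dsimp only; rw [if_pos h2]; exact mem_inter.2 ⟨h2, hc.1⟩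
    · rw [hφdef]; dsimp only; rw [if_neg h2]; exact mem_inter.2 ⟨(hS g hgJ hc).resolve_left h2, hc.2⟩
  have hφp : ∀ g ∈ J.filter (IsChord I J), φ g ∈ andPair I g := by
    intro g _
    by_cases h2 : I.vars g 2 ∈ S
    · rw [hφdef]; dsimp only; rw [if_pos h2]; exact mem_andPair_of_slot I g 2 (by decide)
    · rw [hφdef]; dsimp only; rw [if_neg h2]; exact mem_andPair_of_slot I g 3 (by decide)
  refine card_le_card_of_injOn φ (fun g hg => hφ g hg) fun g hg g' hg' he => ?_
  by_contra hne
  have hd := disjoint_andPair_of_isChord I (mem_filter.1 hg).1 (mem_filter.1 hg').1 (mem_filter.1 hg).2 hne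
  exact disjoint_left.1 hd (hφp g hg) (he ▸ hφp g' hg')

include hB hJr hnx

/-- **The memo's count (★) along the chord route**: under (T1) and expansion, if every chord of `J` has an AND slot in `S` (e.g.
`S = gsupp 𝒲` by (C0)), then `|J| ≤ 2·|S ∩ bdry J|`. -/
theorem card_le_two_mul_of_chords_meet (S : Finset (Fin n)) (hS : ∀ g ∈ J, IsChord I J g → I.vars g 2 ∈ S ∨ I.vars g 3 ∈ S) :
    J.card ≤ 2 * (S ∩ bdry I J).card := by
  classical
  exact (card_le_two_mul_card_chords I J hB hJr hnx).trans (Nat.mul_le_mul_left 2 (card_chords_le_of_meets I J S hS))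

end Count

end Summit.PneNP.PneNP.Theorems.PstarChordSupport
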